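import Summits.ResolutionOfSingularities.ResolutionOfSingularities.Theorems.EquisingularLiftEquisingularLiftNatCarrierDeltaFrameAdapted
import Summits.ResolutionOfSingularities.ResolutionOfSingularities.Theorems.EquisingularLiftEquisingularLiftNatFrameChange
import HarnessLib

/-!
# [OURS · L1 W4.5(b) · EL♮(3)] (δ) D4 — T-FRAME-AT WITH PRESCRIBED CHART AND COORDINATES: the section frame adapted to a point of
# a cluster (`y′_t = [1:0:0]` of chart `0` of the frame `c^{(t)}` of (δ) D2)
# (crux `EquisingularLiftNatThree` stmt-ResolutionOfSingularities-20148 / parent 20038; rung v7′ TC⁺⁺, STEP 0 per subset)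

NOT a statement of any manuscript. Helper file of the chain res-L1-w45b (cell `res-hironaka`, LADDER-RESOLUTION rung L, slot W4.5(b));
OURS; AI-written, weaker than expert review; `--supports stmt-ResolutionOfSingularities-20148 --as helper` by res-L1-w45b-stub-3 (brick D4 of
`L/res-L1-w45b-stub-3/DELTA-PLAN.md`, frame half; res-L1-w45b-plan-1 BOOKING 2026-08-27T16:20:41Z «D4 per-point PACKAGE = stub-3»,
DESK 17:14:53Z «D3b … stays inside stub-3's D2/D4»). No `sorry`; standard axioms; no definitions.

WHAT. res-type-100's T-FRAME-AT `exists_sectionFrame_adapted` (p527425) CHOOSES a chart and the values of the chart coordinates at the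
point and returns SOME adapted frame. At a point `t` of a CLUSTER the chart `i = i t` and the lifted coordinates `ã = ã t : {l ≠ i} → O`
are PRESCRIBED by (δ) D1 `exists_clusterConeLift_subset` (p548257: the cone `Φ_S` is centred at exactly these coordinates), and the frame
must be THE adapted frame of (δ) D2 (…NatFrameChange, p551302), `c' = (c_i, c_{i⁺0} − ι ã₀·c_i, c_{i⁺1} − ι ã₁·c_i)` (`i⁺l = i.succAbove l`,
carried as hypotheses `hc'0 / hc's`), so that the form side (`Φ' = Φ_S ∘ θ`, …NatFrameChangeClauses) and the point side speak of the
same frame. **`exists_clusterFrame_adapted_at`**: from an upstairs section frame `c` at `j x` (`(c) = 𝓘(s)_{j x}`), the chart `i`, the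
coordinates `ã`, and res-type-100's (δ) D3a presentation of the closed point `q′` over `x` ON CHART `i` OF `c̄ = j♯ c` with the TRANSLATED
clause `c̄_l/c̄_i − j♯(ι ã_l) ∈ 𝔮` (`exists_clusterPoint`, …NatClusterPointDict p551356), it returns for `c'` every frame slot of
res-type-100's B4a★ tuple (`exists_centredConeLift_three_exact`, p546008): `(c') = 𝓘(s)_{j x}`, quasi-regular, `𝒪/(c') ≅ O` a domain and
the identity on constants, `(c') + (ϖ) = 𝔪`, `ϖ ∉ (c')`, and the presentation of `𝒪_{F₂,q′}` on chart `0` of `c̄'` with `c̄'₁/c̄'₀,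
c̄'₂/c̄'₀ ∈ 𝔔` — **`q′ = [1:0:0]` in the frame `c'`** (T-FRAME-AT's shape VERBATIM, hence the input of B6a `exists_conePoint_presentation`
p541628 and B6b `exists_axisSection_conePoint` p545343 at `c'`). Proof = T-FRAME-AT's steps (3)–(4) with `exists_translate_swap_coords`
replaced by D2's `span_range_frame_eq`; the transport is res-type-100's `blowupAlgebra_presentation_transport` /
`blowupAlgebra_eq_frac_sub_algebraMap`.

References: res-type-100 p527425 (T-FRAME-AT), p551356 ((δ) D3a), p546008 (B4a★); res-L1-w45b-stub-3 p551302 ((δ) D2). The Stacks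
Project, Tag 0804 [cite: StacksProject, Tag 0804]; H. Matsumura, *Commutative Ring Theory* (1986), Thm. 14.2 [cite: Matsumura1987].
-/

set_option linter.dupNamespace false -- mandated namespace `Summit.<Summit>.<Problem>` of this single-conjunct summit
set_option linter.overlappingInstances false -- signatures carry `[IsDomain O] [IsDiscreteValuationRing O]`

noncomputable section

open CategoryTheory CategoryTheory.Limits AlgebraicGeometry TopologicalSpace IsLocalRing
open Literature.AlgebraicGeometry.Resolution
open AlgebraicGeometry.Scheme.IdealSheafData
open Summit.ResolutionOfSingularities.ResolutionOfSingularities.Cruxes.EquisingularLiftNat.Sections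

namespace Summit.ResolutionOfSingularities.ResolutionOfSingularities.Cruxes.EquisingularLiftNat.Sections.TCPlus

set_option maxHeartbeats 800000 in -- chart algebra of a stalk = subalgebra of a localisation: slow instance unification (as p527425)
/-- **(δ) D4 — T-FRAME-AT with PRESCRIBED chart `i` and coordinates `ã`: the cluster point `q′` is `[1:0:0]` of chart `0` of the adapted
frame `c'` of (δ) D2.** Model square over a DVR `O ↠ k` (`k` algebraically closed; `r'` separated, locally of finite type), section `s`
through `s(s₀) = j x` (`x` closed, `𝒪_{X′,j x}` regular of dimension `3 + 1`), `υ : F₂ → F₁` the blow-up of the reduced point `x`; `c` a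
section frame at `j x` (`(c) = 𝓘(s)_{j x}`), `c'` its D2-adaptation to `(i, ã)`; `q′ ∈ F₂` closed over `x`, presented on chart `i` of
`c̄ = j♯ c` at a prime `𝔮` over `𝔪_x` with `c̄_l/c̄_i − j♯(ι ã_l) ∈ 𝔮` (`l ≠ i`). THEN `c'` is a section frame with all of B4a★'s frame slots
and `𝒪_{F₂,q′}` is presented on chart `0` of `c̄' = j♯ c'` at a prime `𝔔` over `𝔪_x` containing `c̄'₁/c̄'₀`, `c̄'₂/c̄'₀`.
[cite: StacksProject, Tag 0804] [OURS · L1 W4.5b] (δ) D4; NOT a statement of the manuscript. -/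
theorem exists_clusterFrame_adapted_at (O : Type) [CommRing O] [IsDomain O] [IsDiscreteValuationRing O]
    {X' F₁ F₂ : Scheme.{0}} (r' : X' ⟶ Spec (.of O)) [IsSeparated r']
    (s : Spec (.of O) ⟶ X') (hs : s ≫ r' = 𝟙 _) (j : F₁ ⟶ X') (x : F₁)
    (hss : s (IsLocalRing.closedPoint O) = j x) (hreg : IsRegularLocalRing (X'.presheaf.stalk (j x)))
    (hdim : ringKrullDim (X'.presheaf.stalk (j x)) = ((3 + 1 : ℕ) : WithBot ℕ∞)) (ϖ : O) (hϖ : Irreducible ϖ)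
    (υ : F₂ ⟶ F₁) (q' : F₂) (hq' : υ q' = x)
    -- the section frame and its D2-adaptation to the chart `i` and the lifted coordinates `ã`
    (c : Fin 3 → X'.presheaf.stalk (j x)) (hcI : Ideal.span (Set.range c) = stalkIdeal s.ker (j x))
    (i : Fin 3) (a : {l : Fin 3 // l ≠ i} → O) (c' : Fin 3 → X'.presheaf.stalk (j x)) (hc'0 : c' 0 = c i)
    (hc's : ∀ l : Fin 2, c' l.succ = c (i.succAbove l) -
      ((Scheme.ΓSpecIso (.of O)).inv ≫ r'.appTop ≫ X'.presheaf.Γgerm (j x)).hom (a ⟨i.succAbove l, Fin.succAbove_ne i l⟩) * c i)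
    -- (δ) D3a: the presentation of `q′` on chart `i` of `c̄`, translated by `ã`
    (Hp : ∃ (𝔮 : PrimeSpectrum (blowupAlgebra (Ideal.span (Set.range fun l => (j.stalkMap x).hom (c l)))
        ((j.stalkMap x).hom (c i))))
      (χ : blowupAlgebra (Ideal.span (Set.range fun l => (j.stalkMap x).hom (c l))) ((j.stalkMap x).hom (c i)) →+*
        F₂.presheaf.stalk q')
      (e : F₂.presheaf.stalk q' ≃+* Localization.AtPrime 𝔮.asIdeal),
      (∀ r, χ (algebraMap _ _ r) = ((F₁.presheaf.stalkCongr (Inseparable.of_eq hq')).inv ≫ υ.stalkMap q').hom r) ∧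
      @IsLocalization.AtPrime _ _ (F₂.presheaf.stalk q') _ χ.toAlgebra 𝔮.asIdeal _ ∧
      (∀ b, e (χ b) = algebraMap _ (Localization.AtPrime 𝔮.asIdeal) b) ∧
      𝔮.asIdeal.comap (algebraMap _ (blowupAlgebra (Ideal.span (Set.range fun l => (j.stalkMap x).hom (c l)))
        ((j.stalkMap x).hom (c i)))) = maximalIdeal (F₁.presheaf.stalk x) ∧
      ∀ l : {l : Fin 3 // l ≠ i}, blowupAlgebra.frac (fun l => (j.stalkMap x).hom (c l)) i l.1 -
        algebraMap _ _ ((j.stalkMap x).hom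
          (((Scheme.ΓSpecIso (.of O)).inv ≫ r'.appTop ≫ X'.presheaf.Γgerm (j x)).hom (a l))) ∈ 𝔮.asIdeal) :
    ∃ (θR : (X'.presheaf.stalk (j x) ⧸ Ideal.span (Set.range c')) ≃+* O),
      Ideal.span (Set.range c') = stalkIdeal s.ker (j x) ∧ IsQuasiRegular c' ∧
      IsDomain (X'.presheaf.stalk (j x) ⧸ Ideal.span (Set.range c')) ∧
      (∀ b : O, θR (Ideal.Quotient.mk _ ((X'.presheaf.Γgerm (j x)).hom
        (r'.appTop.hom ((Scheme.ΓSpecIso (.of O)).inv.hom b)))) = b) ∧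
      Ideal.span (Set.range c') ⊔ Ideal.span {(X'.presheaf.Γgerm (j x)).hom
        (r'.appTop.hom ((Scheme.ΓSpecIso (.of O)).inv.hom ϖ))} = maximalIdeal (X'.presheaf.stalk (j x)) ∧
      (X'.presheaf.Γgerm (j x)).hom (r'.appTop.hom ((Scheme.ΓSpecIso (.of O)).inv.hom ϖ)) ∉ Ideal.span (Set.range c') ∧
      ∃ (𝔔 : PrimeSpectrum (blowupAlgebra (Ideal.span (Set.range fun l => (j.stalkMap x).hom (c' l)))
          ((j.stalkMap x).hom (c' 0))))
        (χ : blowupAlgebra (Ideal.span (Set.range fun l => (j.stalkMap x).hom (c' l))) ((j.stalkMap x).hom (c' 0)) →+*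
          F₂.presheaf.stalk q')
        (e : F₂.presheaf.stalk q' ≃+* Localization.AtPrime 𝔔.asIdeal),
        (∀ r, χ (algebraMap _ _ r) =
          ((F₁.presheaf.stalkCongr (Inseparable.of_eq hq')).inv ≫ υ.stalkMap q').hom r) ∧
        @IsLocalization.AtPrime _ _ (F₂.presheaf.stalk q') _ χ.toAlgebra 𝔔.asIdeal _ ∧
        (∀ b, e (χ b) = algebraMap _ (Localization.AtPrime 𝔔.asIdeal) b) ∧
        𝔔.asIdeal.comap (algebraMap _ (blowupAlgebra (Ideal.span (Set.range fun l => (j.stalkMap x).hom (c' l)))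
          ((j.stalkMap x).hom (c' 0)))) = maximalIdeal (F₁.presheaf.stalk x) ∧
        ∀ (l : {l : Fin 3 // l ≠ 0}) (y : blowupAlgebra (Ideal.span (Set.range fun l => (j.stalkMap x).hom (c' l)))
            ((j.stalkMap x).hom (c' 0))),
          (y : Localization.Away ((j.stalkMap x).hom (c' 0))) =
            algebraMap _ (Localization.Away ((j.stalkMap x).hom (c' 0))) ((j.stalkMap x).hom (c' l.1)) *
              IsLocalization.Away.invSelf ((j.stalkMap x).hom (c' 0)) → y ∈ 𝔔.asIdeal := by
  classical
  -- (3) the adapted frame spans the section ideal; the frame slots at `j x`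
  have hspan : Ideal.span (Set.range c') = Ideal.span (Set.range c) :=
    span_range_frame_eq i (fun l => ((Scheme.ΓSpecIso (.of O)).inv ≫ r'.appTop ≫ X'.presheaf.Γgerm (j x)).hom
      (a ⟨i.succAbove l, Fin.succAbove_ne i l⟩)) c c' hc'0 hc's
  have hcI' : Ideal.span (Set.range c') = stalkIdeal s.ker (j x) := hspan.trans hcI
  refine (exists_sectionFrame_of_span_eq_forall_at O r' s hs (j x) hss hreg ϖ hϖ c' hcI' hdim).elim fun θR hfr => ?_
  refine ⟨θR, hcI', hfr.1, hfr.2.1, hfr.2.2.1, hfr.2.2.2.1, hfr.2.2.2.2, ?_⟩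
  -- (4) the presentation, transported to chart `0` of the adapted frame downstairs
  have hIeq : Ideal.span (Set.range fun l => (j.stalkMap x).hom (c' l)) =
      Ideal.span (Set.range fun l => (j.stalkMap x).hom (c l)) := by
    have h1 : (Set.range fun l => (j.stalkMap x).hom (c' l)) = (j.stalkMap x).hom '' Set.range c' := Set.range_comp _ _
    have h2 : (Set.range fun l => (j.stalkMap x).hom (c l)) = (j.stalkMap x).hom '' Set.range c := Set.range_comp _ _
    rw [h1, h2, ← Ideal.map_span, ← Ideal.map_span, hspan]
  have haeq : (j.stalkMap x).hom (c' 0) = (j.stalkMap x).hom (c i) := by rw [hc'0]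
  refine Hp.elim fun 𝔮 H => H.elim fun χ H => H.elim fun e H => ?_
  refine blowupAlgebra_presentation_transport _ hIeq haeq (fun l : {l : Fin 3 // l ≠ 0} => (j.stalkMap x).hom (c' l.1))
    ⟨𝔮, χ, e, H.1, H.2.1, H.2.2.1, H.2.2.2.1, fun l y hy => ?_⟩
  -- the element with numerator `c̄'_l`, `l = l′ + 1`, of the chart-`i` algebra is `c̄_{i⁺l′}/c̄_i − j♯(ι ã_{i⁺l′})`
  obtain ⟨l', hl'⟩ := Fin.exists_succ_eq.mpr l.2
  have hnum : (j.stalkMap x).hom (c' l.1) = (j.stalkMap x).hom (c (i.succAbove l')) -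
      (j.stalkMap x).hom (((Scheme.ΓSpecIso (.of O)).inv ≫ r'.appTop ≫ X'.presheaf.Γgerm (j x)).hom
        (a ⟨i.succAbove l', Fin.succAbove_ne i l'⟩)) * (j.stalkMap x).hom (c i) := by
    rw [← hl', hc's, map_sub, map_mul]
  rw [hnum] at hy
  rw [blowupAlgebra_eq_frac_sub_algebraMap (fun l => (j.stalkMap x).hom (c l)) i (i.succAbove l') _ y hy]
  exact H.2.2.2.2 ⟨i.succAbove l', Fin.succAbove_ne i l'⟩

end Summit.ResolutionOfSingularities.ResolutionOfSingularities.Cruxes.EquisingularLiftNat.Sections.TCPlus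

end
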